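import Literature.AnabelianGeometry.SemiGraphs.PSCTwoNodeCycleIncidence
import Literature.AnabelianGeometry.SemiGraphs.PSCTwoNodeCycleOrigin
import Literature.AnabelianGeometry.SemiGraphs.PSCGraphicConverseAssembly
import HarnessLib

/-!
# [CombGC] Prop. 1.5 (i)+(ii) at the TWO-NODE-CYCLE shape: the branch link and the origin (rows F-0440, F-0441)

Mochizuki, *A combinatorial version of the Grothendieck conjecture*, Tohoku Math. J. **59** (2007)
[CombGC], Prop. 1.5 (i) p. 12, (ii) p. 13 [cite: MochizukiCombGC2007, Prop 1.5(ii) p.13].  PROOF-ONLY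
assembly (abc-iut-f-164 gen 5, row «TWO-NODE-CYCLE·PROP15», the part with ≥ 2 cusps on each component):
the branch link "both branches of a node land, after the recorded conjugators, in DISTINCT verticial
subgroups" at the 2-cycle (branch conjugator `ι(a_m)` on the node `⟨b_m⟩`), and the origin of these data,
where Prop. 1.5 (i) (`EdgeLikeIncidenceHolds`, `PSCTwoNodeCycleIncidence`) and Prop. 1.5 (ii)
(`GraphicIffEdgeLikeVerticialHolds`, w4-d081's `graphicIffEdgeLikeVerticialHolds_of_separating`) hold together
with Prop. 1.2 (`PSCTwoNodeCycleOrigin`), inhabited by the sturdy datum "two twice-punctured genus-2 curves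
glued at two points" (`Γ_{5,4}`, `i = n = 2`, `r = 4`).

* `branchLink_of_twoNodeCycle` — the branch link (nodeEnds recorded as `s(v₀, v₁)`);
* `exists_twoNodeCycleOrigin_prop15_holds` — `SeparatingCoveringsHolds ∧ EdgeLikeIncidenceHolds ∧
  GraphicIffEdgeLikeVerticialHolds` at the origin of two-node-cycle data with ≥ 2 cusps on each component.
0 definitions; nothing here takes a side on [IUTchIII] Cor. 3.12.
-/

noncomputable section

namespace Literature.AnabelianGeometry.SemiGraphs

namespace PSCDatum

open scoped Pointwise
open Literature.GroupTheory.CombinatorialGroupTheory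
open Literature.GroupTheory.CombinatorialGroupTheory.PuncturedSurfaceGroup (a b c cuspInertia
  exists_freeGroupBasis_elim_last exists_freeGroupBasis_cycleFirst closure_cycleFirst_eq closure_cycleSecond_eq)
open SemiGraphOfAnabelioids (IsProSigmaCompletion)
open SemiGraphOfAnabelioids.IsProSigmaCompletion (freeFactor_inf_eq infinite_freeFactor)

section Shape

variable {P : Type} [Group P] [TopologicalSpace P] [IsTopologicalGroup P]
variable [CompactSpace P] [T2Space P] [TotallyDisconnectedSpace P] {Sigma : Set ℕ} {g r : ℕ}

omit [CompactSpace P] [TotallyDisconnectedSpace P] in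
/-- The closure of the image of the trivial sub-basis is trivial. [cite: MochizukiCombGC2007, Rmk 1.1.3 p.7] -/
private theorem closure_map_closure_image_empty₂ {Γ : Type*} [Group Γ] (ι : Γ →* P) {β : Type*} (bb : β → Γ) :
    ((Subgroup.closure (bb '' (∅ : Set β))).map ι).topologicalClosure = ⊥ := by
  rw [Set.image_empty, Subgroup.closure_empty, Subgroup.map_bot]
  refine le_antisymm (Subgroup.topologicalClosure_minimal _ le_rfl ?_) bot_le
  rw [Subgroup.coe_bot]
  exact isClosed_singleton

/-- **The branch link at every two-node-cycle datum** (nodeEnds recorded as `s(v₀, v₁)`, `m ≥ 1`,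
`g - m - 1 ≥ 1`, `1 ≤ s ≤ r'`): the two branches of each node land — after the conjugator `ι(a_m)` for the
`v₀`-branch of `⟨b_m⟩`, trivially otherwise — in the representatives `Π_{v₀}`, `Π_{v₁}`, and the resulting
verticial subgroups are DISTINCT (witnesses `a_0`, `b_{m+1}` and `freeFactor_inf_eq`).
[cite: MochizukiCombGC2007, Prop 1.5(ii) p.13] -/
theorem branchLink_of_twoNodeCycle (hne : Sigma.Nonempty)
    (hprime : ∀ p ∈ Sigma, p.Prime) (ι : PuncturedSurfaceGroup g r →* P)
    (hι : IsProSigmaCompletion Sigma ι) (G : PSCDatum P) {m s : ℕ} (hm : m + 2 ≤ g) (hm1 : 1 ≤ m)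
    (hs1 : 1 ≤ s) (hsr : s + 1 ≤ r)
    (v₀ v₁ : G.graph.V)
    (n₁ n₂ : G.graph.N) (hN : ∀ n, n = n₁ ∨ n = n₂) (hends : ∀ n, G.graph.nodeEnds n = s(v₀, v₁))
    (δ : PuncturedSurfaceGroup g r)
    (hδ : δ = (((List.finRange r).map fun j : Fin r =>
        if (j : ℕ) < s then PuncturedSurfaceGroup.c (g := g) j else 1).prod)⁻¹ *
      (((List.finRange g).map fun i : Fin g => if m + 1 ≤ (i : ℕ) then
        PuncturedSurfaceGroup.a (r := r) i * PuncturedSurfaceGroup.b i *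
          (PuncturedSurfaceGroup.a i)⁻¹ * (PuncturedSurfaceGroup.b i)⁻¹ else 1).prod)⁻¹ *
      PuncturedSurfaceGroup.b ⟨m, by omega⟩)
    (hV₀ : G.vertGp v₀ = ((Subgroup.closure {x : PuncturedSurfaceGroup g r |
        (∃ i : Fin g, (i : ℕ) < m ∧ (x = PuncturedSurfaceGroup.a i ∨ x = PuncturedSurfaceGroup.b i)) ∨
        (∃ j : Fin r, s ≤ (j : ℕ) ∧ x = PuncturedSurfaceGroup.c j) ∨
        x = PuncturedSurfaceGroup.a ⟨m, by omega⟩ * PuncturedSurfaceGroup.b ⟨m, by omega⟩ *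
          (PuncturedSurfaceGroup.a ⟨m, by omega⟩)⁻¹ ∨ x = δ}).map ι).topologicalClosure)
    (hV₁ : G.vertGp v₁ = ((Subgroup.closure {x : PuncturedSurfaceGroup g r |
        (∃ i : Fin g, m < (i : ℕ) ∧ (x = PuncturedSurfaceGroup.a i ∨ x = PuncturedSurfaceGroup.b i)) ∨
        (∃ j : Fin r, (j : ℕ) < s ∧ x = PuncturedSurfaceGroup.c j) ∨
        x = PuncturedSurfaceGroup.b ⟨m, by omega⟩ ∨ x = δ}).map ι).topologicalClosure)
    (hE₁ : G.nodeGp n₁ = ((Subgroup.zpowers (PuncturedSurfaceGroup.b (r := r) ⟨m, by omega⟩)).map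
      ι).topologicalClosure)
    (hE₂ : G.nodeGp n₂ = ((Subgroup.zpowers δ).map ι).topologicalClosure) :
    ∀ n : G.graph.N, ∃ (w₁ w₂ : G.graph.V) (γ₁ γ₂ : ConjAct P),
      G.graph.nodeEnds n = s(w₁, w₂) ∧ γ₁ • G.nodeGp n ≤ G.vertGp w₁ ∧
        γ₂ • G.nodeGp n ≤ G.vertGp w₂ ∧ γ₁⁻¹ • G.vertGp w₁ ≠ γ₂⁻¹ • G.vertGp w₂ := by
  classical
  obtain ⟨r', rfl⟩ : ∃ r', r = r' + 1 := ⟨r - 1, by omega⟩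
  have hmg : m < g := by omega
  have hsr' : s ≤ r' := by omega
  have hp : ∃ p ∈ Sigma, p.Prime := hne.imp fun p hp => ⟨hp, hprime p hp⟩
  set km : Fin g := ⟨m, hmg⟩ with hkm
  obtain ⟨bA, haA, hbA, hkA, hcA⟩ := exists_freeGroupBasis_cycleFirst g r' m hmg
  obtain ⟨bl, hal, hbl, hcl⟩ := exists_freeGroupBasis_elim_last g r'
  set S_A : Set ((Fin g × Bool) ⊕ Fin r') := {y | Sum.elim (fun p : Fin g × Bool =>
    (p.1 : ℕ) < m ∨ (p.1 = ⟨m, hmg⟩ ∧ p.2 = true)) (fun j : Fin r' => s ≤ (j : ℕ) + 1) y} with hS_A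
  set S_B : Set ((Fin g × Bool) ⊕ Fin r') := {y | Sum.elim (fun p : Fin g × Bool =>
    m < (p.1 : ℕ) ∨ (p.1 = ⟨m, hmg⟩ ∧ p.2 = true)) (fun j : Fin r' => (j : ℕ) < s) y} with hS_B
  have hV₀A : G.vertGp v₀ = ((Subgroup.closure (bA '' S_A)).map ι).topologicalClosure := by
    rw [hV₀, closure_cycleFirst_eq hmg hδ hs1 haA hbA hkA hcA]
  have hV₁B : G.vertGp v₁ = ((Subgroup.closure (bl '' S_B)).map ι).topologicalClosure := by
    rw [hV₁, closure_cycleSecond_eq hmg hδ hsr' hal hbl hcl]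
  have hle : ∀ (S : Set (PuncturedSurfaceGroup g (r' + 1))) (x : PuncturedSurfaceGroup g (r' + 1)), x ∈ S →
      ((Subgroup.zpowers x).map ι).topologicalClosure ≤ ((Subgroup.closure S).map ι).topologicalClosure :=
    fun S x hx => Subgroup.topologicalClosure_mono (Subgroup.map_mono ((Subgroup.zpowers_le).mpr
      (Subgroup.subset_closure hx)))
  have habs : ∀ (bb : FreeGroupBasis ((Fin g × Bool) ⊕ Fin r') (PuncturedSurfaceGroup g (r' + 1)))
      (p : (Fin g × Bool) ⊕ Fin r'), ι (bb p) = 1 → False := by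
    intro bb p h1
    have hinf := infinite_freeFactor bb {p} ⟨p, rfl⟩ hι hp
    apply (show ((Subgroup.closure (bb '' {p})).map ι).topologicalClosure ≠ ⊥ from fun h => by
      rw [h] at hinf; exact hinf.not_finite inferInstance)
    rw [Set.image_singleton, ← Subgroup.zpowers_eq_closure, MonoidHom.map_zpowers, h1,
      Subgroup.zpowers_one_eq_bot]
    exact le_antisymm (Subgroup.topologicalClosure_minimal _ le_rfl (by
      rw [Subgroup.coe_bot]; exact isClosed_singleton)) bot_le
  -- the two distinctness facts
  have hne₁ : (ConjAct.toConjAct (ι (a km)))⁻¹ • G.vertGp v₀ ≠ G.vertGp v₁ := by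
    intro h
    have ha0V : ι (a (r := r' + 1) ⟨0, by omega⟩) ∈ G.vertGp v₀ := by
      rw [hV₀]
      exact Subgroup.le_topologicalClosure _ (Subgroup.mem_map_of_mem ι
        (Subgroup.subset_closure (Or.inl ⟨⟨0, by omega⟩, by simp; omega, Or.inl rfl⟩)))
    have hw : ι ((a km)⁻¹ * a (r := r' + 1) ⟨0, by omega⟩ * a km) ∈ G.vertGp v₁ := by
      have h2 : (ConjAct.toConjAct (ι (a km)))⁻¹ • ι (a (r := r' + 1) ⟨0, by omega⟩) ∈
          (ConjAct.toConjAct (ι (a km)))⁻¹ • G.vertGp v₀ := Subgroup.smul_mem_pointwise_smul _ _ _ ha0V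
      rw [h, ← map_inv, ConjAct.toConjAct_smul] at h2
      simpa only [map_mul, map_inv, inv_inv] using h2
    set T : Set ((Fin g × Bool) ⊕ Fin r') := {Sum.inl (km, false), Sum.inl (⟨0, by omega⟩, false)} with hT
    have hwT : (a km)⁻¹ * a (r := r' + 1) ⟨0, by omega⟩ * a km ∈ Subgroup.closure (bl '' T) := by
      have h1 : a (r := r' + 1) km ∈ Subgroup.closure (bl '' T) :=
        Subgroup.subset_closure ⟨Sum.inl (km, false), by simp [hT], hal km⟩
      have h0 : a (r := r' + 1) ⟨0, by omega⟩ ∈ Subgroup.closure (bl '' T) :=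
        Subgroup.subset_closure ⟨Sum.inl (⟨0, by omega⟩, false), by simp [hT], hal _⟩
      exact Subgroup.mul_mem _ (Subgroup.mul_mem _ (Subgroup.inv_mem _ h1) h0) h1
    have hST : S_B ∩ T = ∅ := by
      ext y
      simp only [Set.mem_inter_iff, Set.mem_empty_iff_false, iff_false, not_and, hT, Set.mem_insert_iff,
        Set.mem_singleton_iff]
      rintro hy (rfl | rfl)
      · rcases hy with hy | ⟨-, hy⟩
        · exact absurd hy (by simp [km])
        · exact absurd hy (by simp)
      · rcases hy with hy | ⟨hy, -⟩
        · exact absurd hy (by simp)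
        · exact absurd hy (fun h' => by have := congrArg Fin.val h'; simp at this; omega)
    have hmem : ι ((a km)⁻¹ * a (r := r' + 1) ⟨0, by omega⟩ * a km) ∈
        ((Subgroup.closure (bl '' S_B)).map ι).topologicalClosure ⊓
          ((Subgroup.closure (bl '' T)).map ι).topologicalClosure :=
      ⟨hV₁B ▸ hw, Subgroup.le_topologicalClosure _ (Subgroup.mem_map_of_mem ι hwT)⟩
    rw [freeFactor_inf_eq bl S_B T hι, hST, closure_map_closure_image_empty₂, Subgroup.mem_bot, map_mul,
      map_mul, map_inv] at hmem
    have h1 : ι (a (r := r' + 1) ⟨0, by omega⟩) = 1 := by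
      have := congrArg (fun t => ι (a km) * t * (ι (a km))⁻¹) hmem
      simpa only [mul_one, mul_inv_cancel, ← mul_assoc, mul_inv_cancel_left, one_mul, mul_inv_cancel_right]
        using this
    exact habs bl (Sum.inl (⟨0, by omega⟩, false)) (by rw [hal]; exact h1)
  have hne₂ : G.vertGp v₀ ≠ G.vertGp v₁ := by
    intro h
    have hb1 : ι (PuncturedSurfaceGroup.b (r := r' + 1) ⟨m + 1, by omega⟩) ∈ G.vertGp v₁ := by
      rw [hV₁]
      exact Subgroup.le_topologicalClosure _ (Subgroup.mem_map_of_mem ι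
        (Subgroup.subset_closure (Or.inl ⟨⟨m + 1, by omega⟩, by simp, Or.inr rfl⟩)))
    set T : Set ((Fin g × Bool) ⊕ Fin r') := {Sum.inl (⟨m + 1, by omega⟩, true)} with hT
    have hbT : PuncturedSurfaceGroup.b (r := r' + 1) ⟨m + 1, by omega⟩ ∈ Subgroup.closure (bA '' T) :=
      Subgroup.subset_closure ⟨Sum.inl (⟨m + 1, by omega⟩, true), by simp [hT],
        hbA _ (fun h' => by have := congrArg Fin.val h'; simp at this)⟩
    have hST : S_A ∩ T = ∅ := by
      ext y
      simp only [Set.mem_inter_iff, Set.mem_empty_iff_false, iff_false, not_and, hT, Set.mem_singleton_iff]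
      rintro hy rfl
      rcases hy with hy | ⟨hy, -⟩
      · exact absurd hy (by simp)
      · exact absurd hy (fun h' => by have := congrArg Fin.val h'; simp at this)
    have hmem : ι (PuncturedSurfaceGroup.b (r := r' + 1) ⟨m + 1, by omega⟩) ∈
        ((Subgroup.closure (bA '' S_A)).map ι).topologicalClosure ⊓
          ((Subgroup.closure (bA '' T)).map ι).topologicalClosure :=
      ⟨hV₀A ▸ h ▸ hb1, Subgroup.le_topologicalClosure _ (Subgroup.mem_map_of_mem ι hbT)⟩
    rw [freeFactor_inf_eq bA S_A T hι, hST, closure_map_closure_image_empty₂, Subgroup.mem_bot] at hmem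
    exact habs bA (Sum.inl (⟨m + 1, by omega⟩, true))
      (by rw [hbA _ (fun h' => by have := congrArg Fin.val h'; simp at this)]; exact hmem)
  intro n
  rcases hN n with rfl | rfl
  · refine ⟨v₀, v₁, ConjAct.toConjAct (ι (a km)), 1, hends _, ?_, ?_, ?_⟩
    · rw [hE₁, toConjAct_smul_topologicalClosure_map_zpowers, hV₀]
      exact hle _ _ (Or.inr (Or.inr (Or.inl rfl)))
    · rw [one_smul, hE₁, hV₁]
      exact hle _ _ (Or.inr (Or.inr (Or.inl rfl)))
    · rw [inv_one, one_smul]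
      exact hne₁
  · refine ⟨v₀, v₁, 1, 1, hends _, ?_, ?_, ?_⟩
    · rw [one_smul, hE₂, hV₀]
      exact hle _ _ (Or.inr (Or.inr (Or.inr rfl)))
    · rw [one_smul, hE₂, hV₁]
      exact hle _ _ (Or.inr (Or.inr (Or.inr rfl)))
    · rw [inv_one, one_smul, one_smul]
      exact hne₂

end Shape

/-! ### The origin of two-node-cycle data with ≥ 2 cusps on each component -/

/-- **[CombGC] Prop. 1.5 (i) (F-0440) and (ii) (F-0441), with F-2829/F-2830, at the origin of two-node-cycle data
with at least two cusps on each component** (`m ≥ 1`, `g - m - 1 ≥ 1`, `2 ≤ s ≤ r - 2`, nodeEnds recorded),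
hypothesis-free, inhabited by the STURDY datum "two twice-punctured genus-`2` curves glued at two points"
(`Γ_{5,4}`, `i = n = 2`, `r = 4`) — the first dual graph with a cycle at which Prop. 1.5 is settled.
[cite: MochizukiCombGC2007, Prop 1.5(ii) p.13] -/
theorem exists_twoNodeCycleOrigin_prop15_holds (Sigma : Set ℕ) (hne : Sigma.Nonempty)
    (hprime : ∀ p ∈ Sigma, p.Prime) :
    ∃ Ω : PSCOrigin.{0},
      (∃ (Q : ProfiniteGrp.{0}) (G : PSCDatum Q), Ω.IsOfPSCType G ∧ G.IsSturdy ∧ G.Sigma = Sigma ∧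
        G.graph.i = 2 ∧ G.graph.n = 2 ∧ G.graph.r = 4) ∧
      SeparatingCoveringsHolds Ω ∧ EdgeLikeIncidenceHolds Ω ∧ GraphicIffEdgeLikeVerticialHolds Ω := by
  classical
  let Ω : PSCOrigin.{0} :=
    ⟨fun {Q} _ _ G => ∃ (_ : IsTopologicalGroup Q), CompactSpace Q ∧ T2Space Q ∧ TotallyDisconnectedSpace Q ∧
      ∃ (S : Set ℕ) (g r m s : ℕ) (hm : m + 2 ≤ g) (ι : PuncturedSurfaceGroup g r →* Q)
        (e : G.graph.C ≃ Fin r) (v₀ v₁ : G.graph.V) (n₁ n₂ : G.graph.N),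
        S.Nonempty ∧ (∀ p ∈ S, p.Prime) ∧ IsProSigmaCompletion S ι ∧ 1 ≤ m ∧ 2 ≤ s ∧ s + 2 ≤ r ∧
        (∀ c, G.cuspGp c =
          ((PuncturedSurfaceGroup.cuspInertia (g := g) (e c)).map ι).topologicalClosure) ∧
        (∀ w, w = v₀ ∨ w = v₁) ∧ n₁ ≠ n₂ ∧ (∀ n, n = n₁ ∨ n = n₂) ∧ (∀ n, G.graph.nodeEnds n = s(v₀, v₁)) ∧
        G.vertGp v₀ = ((Subgroup.closure {x : PuncturedSurfaceGroup g r |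
          (∃ i : Fin g, (i : ℕ) < m ∧ (x = PuncturedSurfaceGroup.a i ∨ x = PuncturedSurfaceGroup.b i)) ∨
          (∃ j : Fin r, s ≤ (j : ℕ) ∧ x = PuncturedSurfaceGroup.c j) ∨
          x = PuncturedSurfaceGroup.a ⟨m, by omega⟩ * PuncturedSurfaceGroup.b ⟨m, by omega⟩ *
            (PuncturedSurfaceGroup.a ⟨m, by omega⟩)⁻¹ ∨
          x = (((List.finRange r).map fun j : Fin r =>
              if (j : ℕ) < s then PuncturedSurfaceGroup.c (g := g) j else 1).prod)⁻¹ *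
            (((List.finRange g).map fun i : Fin g => if m + 1 ≤ (i : ℕ) then
              PuncturedSurfaceGroup.a (r := r) i * PuncturedSurfaceGroup.b i *
                (PuncturedSurfaceGroup.a i)⁻¹ * (PuncturedSurfaceGroup.b i)⁻¹ else 1).prod)⁻¹ *
            PuncturedSurfaceGroup.b ⟨m, by omega⟩}).map ι).topologicalClosure ∧
        G.vertGp v₁ = ((Subgroup.closure {x : PuncturedSurfaceGroup g r |
          (∃ i : Fin g, m < (i : ℕ) ∧ (x = PuncturedSurfaceGroup.a i ∨ x = PuncturedSurfaceGroup.b i)) ∨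
          (∃ j : Fin r, (j : ℕ) < s ∧ x = PuncturedSurfaceGroup.c j) ∨
          x = PuncturedSurfaceGroup.b ⟨m, by omega⟩ ∨
          x = (((List.finRange r).map fun j : Fin r =>
              if (j : ℕ) < s then PuncturedSurfaceGroup.c (g := g) j else 1).prod)⁻¹ *
            (((List.finRange g).map fun i : Fin g => if m + 1 ≤ (i : ℕ) then
              PuncturedSurfaceGroup.a (r := r) i * PuncturedSurfaceGroup.b i *
                (PuncturedSurfaceGroup.a i)⁻¹ * (PuncturedSurfaceGroup.b i)⁻¹ else 1).prod)⁻¹ *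
            PuncturedSurfaceGroup.b ⟨m, by omega⟩}).map ι).topologicalClosure ∧
        G.nodeGp n₁ = ((Subgroup.zpowers (PuncturedSurfaceGroup.b (r := r) ⟨m, by omega⟩)).map
          ι).topologicalClosure ∧
        G.nodeGp n₂ = ((Subgroup.zpowers ((((List.finRange r).map fun j : Fin r =>
              if (j : ℕ) < s then PuncturedSurfaceGroup.c (g := g) j else 1).prod)⁻¹ *
            (((List.finRange g).map fun i : Fin g => if m + 1 ≤ (i : ℕ) then
              PuncturedSurfaceGroup.a (r := r) i * PuncturedSurfaceGroup.b i *
                (PuncturedSurfaceGroup.a i)⁻¹ * (PuncturedSurfaceGroup.b i)⁻¹ else 1).prod)⁻¹ *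
            PuncturedSurfaceGroup.b ⟨m, by omega⟩)).map ι).topologicalClosure⟩
  have hsep : SeparatingCoveringsHolds Ω := by
    intro Q _ _ _ G hG
    obtain ⟨_, hc, ht, hd, S, g, r, m, s, hm, ι, e, v₀, v₁, n₁, n₂, hSne, hSp, hι, hm1, hs2, hsr, hC, hV, hn,
      hN, -, hV₀, hV₁, hE₁, hE₂⟩ := hG
    haveI := hc
    haveI := hd
    exact G.separatingCoverings_of_twoNodeCycle hSne hSp ι hι hm hm1 (by omega) (by omega) e hC v₀ v₁ hV n₁ n₂
      hn hN _ rfl hV₀ hV₁ hE₁ hE₂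
  have hprof : ∀ ⦃Q : Type⦄ [Group Q] [TopologicalSpace Q] [IsTopologicalGroup Q] (G : PSCDatum Q),
      Ω.IsOfPSCType G → CompactSpace Q ∧ TotallyDisconnectedSpace Q := fun Q _ _ _ G hG => by
    obtain ⟨_, hc, -, hd, -⟩ := hG
    exact ⟨hc, hd⟩
  have h15 : EdgeLikeIncidenceHolds Ω := by
    intro Q _ _ G hG
    obtain ⟨hT, hc, ht, hd, S, g, r, m, s, hm, ι, e, v₀, v₁, n₁, n₂, hSne, hSp, hι, hm1, hs2, hsr, hC, hV, hn,
      hN, -, hV₀, hV₁, hE₁, hE₂⟩ := hG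
    haveI := hT
    haveI := hc
    haveI := ht
    haveI := hd
    exact G.edgeLikeIncidence_of_twoNodeCycle hSne hSp ι hι hm hm1 hs2 hsr e hC v₀ v₁ hV n₁ n₂ hN _ rfl
      hV₀ hV₁ hE₁ hE₂
  have hbr : ∀ ⦃Q : Type⦄ [Group Q] [TopologicalSpace Q] [IsTopologicalGroup Q] (G : PSCDatum Q),
      Ω.IsOfPSCType G → ∀ e : G.graph.N, ∃ (v₁ v₂ : G.graph.V) (γ₁ γ₂ : ConjAct Q),
        G.graph.nodeEnds e = s(v₁, v₂) ∧ γ₁ • G.nodeGp e ≤ G.vertGp v₁ ∧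
          γ₂ • G.nodeGp e ≤ G.vertGp v₂ ∧ γ₁⁻¹ • G.vertGp v₁ ≠ γ₂⁻¹ • G.vertGp v₂ := by
    intro Q _ _ _ G hG
    obtain ⟨_, hc, ht, hd, S, g, r, m, s, hm, ι, e, v₀, v₁, n₁, n₂, hSne, hSp, hι, hm1, hs2, hsr, hC, hV, hn,
      hN, hends, hV₀, hV₁, hE₁, hE₂⟩ := hG
    haveI := hc
    haveI := ht
    haveI := hd
    exact G.branchLink_of_twoNodeCycle hSne hSp ι hι hm hm1 (by omega) (by omega) v₀ v₁ n₁ n₂ hN hends _ rfl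
      hV₀ hV₁ hE₁ hE₂
  refine ⟨Ω, ?_, hsep, h15, graphicIffEdgeLikeVerticialHolds_of_separating Ω hsep hprof h15 hbr⟩
  -- the sturdy member: `Γ_{5,4}`, `m = 2`, `s = 2`
  obtain ⟨Q, ι, G, e, v₀, v₁, n₁, n₂, hι, hS, hi, hn, hr, hC, hV, hN, hV₀, hV₁, hE₁, hE₂, hg₀, hg₁, hends⟩ :=
    exists_twoNodeCycleDatum Sigma hne hprime 5 4 2 2 (by norm_num)
  have hne12 : n₁ ≠ n₂ := G.nodes_ne_of_n_eq_two n₁ n₂ hN hn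
  refine ⟨Q, G, ?_, fun v => ?_, hS, hi, hn, hr⟩
  · exact ⟨inferInstance, inferInstance, inferInstance, inferInstance, Sigma, 5, 4, 2, 2, by norm_num, ι, e,
      v₀, v₁, n₁, n₂, hne, hprime, hι, by norm_num, le_rfl, le_rfl, hC, hV, hne12, hN, hends, hV₀, hV₁, hE₁,
      hE₂⟩
  · rcases hV v with rfl | rfl
    · rw [hg₀]
    · rw [hg₁]

end PSCDatum

end Literature.AnabelianGeometry.SemiGraphs

end
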